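import Literature.MathematicalPhysics.QuantumFieldTheory.Balaban1983to89.B9Eq326ConjugatedDeltaA
import Literature.MathematicalPhysics.QuantumFieldTheory.Balaban1983to89.B9Eq349BondBlockDecayFromCircle
import Literature.MathematicalPhysics.QuantumFieldTheory.Balaban1983to89.B9Eq3101ExpPointwiseMultiplier

/-!
# `Balaban1983to89.B9Eq326DeltaABlockDecay` — T. Bałaban, *Propagators for lattice gauge theories in a background field*, Commun. Math. Phys. **99** (1985)
# 389–434 [Balaban1985BackgroundPropagators] (3.26) p. 395, Thm 3.11 p. 416 *«… Δ_a, G are positive … the kernels … decay exponentially»*, (3.49) p. 399,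
# with [Balaban1985Variational] (110) p. 294: **THE `L²` BLOCK DECAY OF THE BOND PROPAGATOR `G₁(U) = Δ_a(U)⁻¹` —
# `‖P_{y₁} ∘ G₁(U) ∘ P_{y₀}‖ ≤ (4∕γ)·e^{r}·e^{−r·d_m(y₀,y₁)}`** for the bond-field blocks `P_y` of the one-step torus and `Q : L²(fine bonds) → L²(coarse bonds)`,
# from the circle form of `B9Eq326ConjugatedDeltaA.norm_conjG1ofU_le` (Combes–Thomas on `Δ_a` WITH ITS PROJECTED SQUARE `D_UR(U)D*_U`) and the bond-block
# read-out with companion weight `B9Eq349BondBlockDecayFromCircle.norm_bondBlock_le_exp_of_uniform_circle_bound` — the (D-E)-shaped letter of `G₁(U)` itself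
# (NOT of the local part `A₀`), reached WITHOUT a gradient row and WITHOUT the Schur complement; letters displayed uniformly over the fine weights `χ`, their
# coarse companions `χ′` and the circle, IN THE SHAPE OF `B9Eq3126QG1QInvPointDecay`'s `hQK` (`dQ` with `e^{κM_F}Qe^{−κM_B}`, `dQ′` with `e^{κM_B}Q†e^{−κM_F}`,
# `dK`, `dR`) so that the `G₁` END and the `(QG₁Q*)⁻¹` END compose into the `H₁` row (`B9Eq3126H1BlockDecayOfLetters`) on the same letters: `γ` (Thm 3.11),
# `p_K`, `β_K`, the conjugated `Q(U)` letters (supplier: t4-ne9-p1's `B9Eq349ConjugatedQLetters`), the conjugated-projection letter `ρ`, and `C_P`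

statement-level skeleton of published theorems with citation tags; proofs where landed; nothing here is a claim about the Yang–Mills mass gap

CITATION HEADER (lean-in-tree rule).  Audit cell `pub-balaban`, sub-cell `t4`, BINDER row NE9; filed by NE9 formalisation-swarm leaf prover 03
(`b2b-balaban-t4-ne9-formalise-leaf-03`, gen 76; v1 of gen 75 imported the NE9 owner's (D0-d) `B9Eq326LocalPartBlockDecay` §2 and displayed the `Q` letter
in factorised `∃ Q_κ Q′_κ` form — v2 reads the block decay out of this lineage's `B9Eq349BondBlockDecayFromCircle` and builds `Q_κ := e^{κM_F}Qe^{−κM_B}`,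
`Q′_κ := e^{κM_B}Q†e^{−κM_F}` itself; the §1∕§2 proof text still follows (D0-d) §1∕§3 letter for letter — CREDIT: t4-ne9-p1 g92).  Imports this lineage's
`B9Eq326ConjugatedDeltaA` (the conjugated bound) and `B9Eq349BondBlockDecayFromCircle`, road B8″'s (G) `B9Eq3101ExpPointwiseMultiplier`.  Sources READ
first-hand (`paper:balaban1985-cmp99-background-propagators`): p. 395 (3.26), p. 416 Thm 3.11, p. 399 (3.49); [Balaban1985Variational] p. 294 (110).  Print's
road is the random walk of Sect. C with local gauge fixing; the conjugation is the ROUTE's Combes–Thomas substitute; nothing of print's rate is asserted.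

WHAT IS PROVED (sorry-free; proof lane — no `def`; [folklore] composition BY NAME).
* §1 **`norm_conjG1ofU_le_of_circle`** — for multiplier CLMs `M_B` (fine bonds, symbol `χ(b₋)`), `M_P` (plaquettes, `χ(p₀)`), `M_S` (sites, `χ(x)`), `M_F` (coarse
  bonds, `χ′(b′₋)`) and one `κ` of the circle `‖κ‖ = r`: `‖exp(κ•M_B) ∘ G₁(U) ∘ exp(−κ•M_B)‖ ≤ 4∕γ`, the letters of `B9Eq326ConjugatedDeltaA.norm_conjG1ofU_le` taken
  at `S^{±} := exp(±κ•M_·)`, `Q_κ := e^{κM_F}Qe^{−κM_B}`, `Q′_κ := e^{κM_B}Q†e^{−κM_F}` (factorisation by `e^{−κM_F}e^{κM_F} = 1`), radius windows `rℓη ≤ 1`,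
  `4rℓM_φM_φ′d√d ≤ β`, `4rℓM_φM_φ′d ≤ β`, `2rℓM_φM_φ′√d ≤ β`; the four conjugation letters `dQ, dQ′, dK, dR` DISPLAYED at this `κ`, `C_P` displayed once.
* §2 **`norm_block_G1ofU_le`** — THE INSTANCE on the one-step torus at the diagonal `ηL = 1` (`1 ≤ ℓ`, `1 ≤ ℓ′`): for every background of the letters, given
  the `γ`-coercivity of `Δ_a` (Thm 3.11), the `Δ′` floor `p_K`, `ρ ≤ 1∕8`, `C_P`, the window `p_K∕2 + (21+3a)β² + 4βC_P + 2ρC_P² + β_K ≤ γ∕4`, and the conjugated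
  `Q`∕`Δ′`∕`R(U)` letters supplied UNIFORMLY over the fine weights (bond increments `≤ ℓη`), their coarse companions (`|χ′(y) − χ(x)| ≤ ℓ′` on blocks) and the
  circle (displayed, `B9Eq3126QG1QInvPointDecay`'s shape verbatim): `‖P_{y₁} ∘ G₁(U) ∘ P_{y₀}‖ ≤ (4∕γ)·e^{r}·e^{−r·d_m(y₀,y₁)}`.
HONEST SCOPE.  Composition; displayed: `γ`, `p_K`, `β_K`, the `Q(U)` letters, `ρ` (supplier: `B9Eq349ConjugatedProjectionDifferenceChain`), `C_P` (supplier: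
`B9Eq325ProjectionDivergenceQuarterKappa`); rate `r` = whatever the windows allow; nothing of [B9] Thm 3.1∕3.3∕3.11 asserted, valued or discharged; «NE9 ⇐ the
named binders»; NE9 NOT PRINTED ∕ NOT PROVED; row WALLED ON A MODEL (O-NE9-1; #5 UNRULED); spine PROVED 0∕9; rung (B)+1 on a finite T⁴ — NOT infinite volume, NOT
mass gap, NOT BetaPertH, NOT Clay.  HONEST DEPENDENCY: continuum YM on T⁴ ⇐ BetaPertH ∧ nine spine estimates (0/9 proved); BetaPertH ⇐ (D1) ∧ (D4) ∧ CAP+tail.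
NEW file; nothing modified.  Net new unproved facts: 0.
-/

noncomputable section

set_option autoImplicit false

open scoped InnerProductSpace ComplexConjugate
open NormedSpace

namespace Literature.MathematicalPhysics.QuantumFieldTheory.Balaban1983to89.B9Eq326DeltaABlockDecay

open B4Sect5Torus (TSite tdist)
open B9SectCLatticeCarrier (Bond bpos btgt)
open B9Eq311L2Pairing (WL2)
open B9Eq319QprimeTorus (fineP blockCoord)
open B7Prop1Explicit (U1)
open B11Eq103H1Complex (SiteL2K BondL2K covDivL2K)
open B9Eq310HessianOperator (adTransportW PlaqL2K curvOp)
open B9Eq326OperatorAssembly (laplaceAofU RofU G1ofU)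
open B9Eq326ConjugatedDeltaA (norm_conjG1ofU_le apply_inv_apply')
open B9Eq349BondBlockDecayFromCircle (norm_bondBlock_le_exp_of_uniform_circle_bound)
open B9Eq3101ExpPointwiseMultiplier (equiv_exp_smul_apply_complex equiv_exp_smul_neg_apply_complex)
open B9Eq387IMSLocalLettersLattice (exists_pointwise_clm)

/-! ## §1 The circle form of the conjugated bound for `G₁(U)` -/

section Circle

variable {d : ℕ} (L : ℕ) [NeZero L] (m : Fin d → ℕ) {𝔸 : Type*} [NormedRing 𝔸] [StarRing 𝔸] [NormedAlgebra ℂ 𝔸] [StarModule ℂ 𝔸] [NormOneClass 𝔸]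
  {W : Type*} [NormedAddCommGroup W] [InnerProductSpace ℂ W] [FiniteDimensional ℂ W] (φ : W ≃ₗ[ℂ] 𝔸) {Mφ Mφ' : ℝ}
  (hφ : ∀ w, ‖φ w‖ ≤ Mφ * ‖w‖) (hφ' : ∀ X, ‖φ.symm X‖ ≤ Mφ' * ‖X‖) (hMφ : 0 ≤ Mφ) (hMφ' : 0 ≤ Mφ')
  {c₀ : ℝ} [Fact (0 < c₀)] {η : ℝ} (hη : 0 < η) (U : Bond d (fineP L m) → 𝔸ˣ) (hU : ∀ b, U b ∈ U1 𝔸)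
  (hRS : ∀ (b : Bond d (fineP L m)) (v u : W), ⟪adTransportW φ U b v, u⟫_ℂ = ⟪v, adTransportW φ (fun b => (U b)⁻¹) b u⟫_ℂ)
  (τ : 𝔸 →ₗ[ℂ] ℂ) {c₁ : ℝ} [Fact (0 < c₁)]
  (Q : BondL2K ℂ d (fineP L m) c₀ W →ₗ[ℂ] BondL2K ℂ d m c₁ W) (a : ℝ)
  {χ : TSite d (fineP L m) → ℝ} {χ' : TSite d m → ℝ}
  {MB : BondL2K ℂ d (fineP L m) c₀ W →L[ℂ] BondL2K ℂ d (fineP L m) c₀ W}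
  (hMB : ∀ (g : BondL2K ℂ d (fineP L m) c₀ W) (b : Bond d (fineP L m)),
    WL2.equiv ℂ (fun _ : Bond d (fineP L m) => c₀) W (MB g) b = (χ (bpos b) : ℂ) • WL2.equiv ℂ (fun _ : Bond d (fineP L m) => c₀) W g b)
  {MP : PlaqL2K ℂ d (fineP L m) c₀ W →L[ℂ] PlaqL2K ℂ d (fineP L m) c₀ W}
  (hMP : ∀ (g : PlaqL2K ℂ d (fineP L m) c₀ W) (p : B9SectCLatticeCarrier.Plaq d (fineP L m)),
    WL2.equiv ℂ (fun _ : B9SectCLatticeCarrier.Plaq d (fineP L m) => c₀) W (MP g) p =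
      (χ p.1 : ℂ) • WL2.equiv ℂ (fun _ : B9SectCLatticeCarrier.Plaq d (fineP L m) => c₀) W g p)
  {MS : SiteL2K ℂ d (fineP L m) c₀ W →L[ℂ] SiteL2K ℂ d (fineP L m) c₀ W}
  (hMS : ∀ (g : SiteL2K ℂ d (fineP L m) c₀ W) (x : TSite d (fineP L m)),
    WL2.equiv ℂ (fun _ : TSite d (fineP L m) => c₀) W (MS g) x = (χ x : ℂ) • WL2.equiv ℂ (fun _ : TSite d (fineP L m) => c₀) W g x)
  {MF : BondL2K ℂ d m c₁ W →L[ℂ] BondL2K ℂ d m c₁ W}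
  (hMF : ∀ (g : BondL2K ℂ d m c₁ W) (b' : Bond d m),
    WL2.equiv ℂ (fun _ : Bond d m => c₁) W (MF g) b' = (χ' (bpos b') : ℂ) • WL2.equiv ℂ (fun _ : Bond d m => c₁) W g b')

include hφ hφ' hMφ hMφ' hη hU hRS hMB hMP hMS hMF in
/-- **THE CONJUGATED BOND PROPAGATOR AT ONE `κ` OF THE CIRCLE `‖κ‖ = r`**: `‖exp(κ•M_B) ∘ G₁(U) ∘ exp(−κ•M_B)‖ ≤ 4∕γ` — `norm_conjG1ofU_le` at the operator
exponentials of the fine multipliers (pointwise `e^{±κχ}` by (G)) with `Q_κ := e^{κM_F}Qe^{−κM_B}`, `Q′_κ := e^{κM_B}Q†e^{−κM_F}` (the coarse multiplier `M_F` by the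
companion `χ′(b′₋)`; factorisation by `e^{−κM_F}e^{κM_F} = 1`), radius windows, the four conjugation letters `dQ, dQ′, dK, dR` displayed AT THIS `κ` in the shape of
`B9Eq3126QG1QInvPointDecay`'s `hQK`, `C_P` displayed.
[cite: Balaban1985BackgroundPropagators, (3.26) p.395, Thm 3.11 p.416, (3.49) p.399; Balaban1985Variational, (110) p.294] -/
theorem norm_conjG1ofU_le_of_circle (ha : 0 ≤ a)
    (hpos : ∀ x : BondL2K ℂ d (fineP L m) c₀ W, x ≠ 0 → 0 < RCLike.re ⟪x, laplaceAofU L m φ η U τ Q a x⟫_ℂ)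
    {γ β βK pK ℓ r ρ CP : ℝ} (hγ : 0 < γ) (hβ : 0 ≤ β) (hℓ : 0 ≤ ℓ) (hρ : 0 ≤ ρ) (hρ8 : ρ ≤ 1 / 8) (hCP : 0 ≤ CP)
    (hcoer : ∀ f : BondL2K ℂ d (fineP L m) c₀ W, γ * ‖f‖ ^ 2 ≤ RCLike.re ⟪f, laplaceAofU L m φ η U τ Q a f⟫_ℂ)
    (hKre : ∀ f : BondL2K ℂ d (fineP L m) c₀ W, -(pK * ‖f‖ ^ 2) ≤ RCLike.re ⟪f, curvOp φ τ η U f⟫_ℂ)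
    (hχ : ∀ b : Bond d (fineP L m), |χ (bpos b) - χ (btgt b)| ≤ ℓ * η) (hwin : r * ℓ * η ≤ 1)
    (hβCC : 4 * r * ℓ * (Mφ * Mφ') * (d * Real.sqrt d) ≤ β) (hβC : 4 * r * ℓ * (Mφ * Mφ') * d ≤ β)
    (hβD : 2 * r * ℓ * (Mφ * Mφ') * Real.sqrt d ≤ β)
    (hP : ∀ f, ‖covDivL2K ℂ c₀ ((η : ℂ))⁻¹ (adTransportW φ fun b => (U b)⁻¹) f -
      RofU L m φ η U (c₀ := c₀) (covDivL2K ℂ c₀ ((η : ℂ))⁻¹ (adTransportW φ fun b => (U b)⁻¹) f)‖ ≤ CP * ‖f‖)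
    (small : pK / 2 + (21 + 3 * a) * β ^ 2 + 4 * β * CP + 2 * ρ * CP ^ 2 + βK ≤ γ / 4) (κ : ℂ) (hκr : ‖κ‖ = r)
    (dQ : ∀ f, ‖exp (κ • MF) (Q (exp (κ • (-MB)) f)) - Q f‖ ≤ β * ‖f‖)
    (dQ' : ∀ g, ‖exp (κ • MB) (LinearMap.adjoint Q (exp (κ • (-MF)) g)) - LinearMap.adjoint Q g‖ ≤ β * ‖g‖)
    (dK : ∀ f, ‖exp (κ • MB) (curvOp φ τ η U (exp (κ • (-MB)) f)) - curvOp φ τ η U f‖ ≤ βK * ‖f‖)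
    (dR : ∀ s, ‖exp (κ • MS) (RofU L m φ η U (c₀ := c₀) (exp (κ • (-MS)) s)) - RofU L m φ η U (c₀ := c₀) s‖ ≤ ρ * ‖s‖) :
    ‖exp (κ • MB) ∘L LinearMap.toContinuousLinearMap (G1ofU L m φ η U τ hpos) ∘L exp (κ • (-MB))‖ ≤ 4 / γ := by
  refine ContinuousLinearMap.opNorm_le_bound _ (by positivity) fun v => ?_
  -- the six multipliers at this `κ`, as linear maps with their pointwise actions
  have hS : ∀ (g : BondL2K ℂ d (fineP L m) c₀ W) (b : Bond d (fineP L m)),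
      WL2.equiv ℂ (fun _ : Bond d (fineP L m) => c₀) W
          (((exp (κ • MB) : BondL2K ℂ d (fineP L m) c₀ W →L[ℂ] BondL2K ℂ d (fineP L m) c₀ W) :
            BondL2K ℂ d (fineP L m) c₀ W →ₗ[ℂ] BondL2K ℂ d (fineP L m) c₀ W) g) b =
        Complex.exp (κ * (χ (bpos b) : ℂ)) • WL2.equiv ℂ (fun _ : Bond d (fineP L m) => c₀) W g b :=
    fun g b => equiv_exp_smul_apply_complex MB (fun b => χ (bpos b)) hMB κ g b
  have hSinv : ∀ (g : BondL2K ℂ d (fineP L m) c₀ W) (b : Bond d (fineP L m)),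
      WL2.equiv ℂ (fun _ : Bond d (fineP L m) => c₀) W
          (((exp (κ • (-MB)) : BondL2K ℂ d (fineP L m) c₀ W →L[ℂ] BondL2K ℂ d (fineP L m) c₀ W) :
            BondL2K ℂ d (fineP L m) c₀ W →ₗ[ℂ] BondL2K ℂ d (fineP L m) c₀ W) g) b =
        Complex.exp (-(κ * (χ (bpos b) : ℂ))) • WL2.equiv ℂ (fun _ : Bond d (fineP L m) => c₀) W g b :=
    fun g b => equiv_exp_smul_neg_apply_complex MB (fun b => χ (bpos b)) hMB κ g b
  have hSP : ∀ (g : PlaqL2K ℂ d (fineP L m) c₀ W) (p : B9SectCLatticeCarrier.Plaq d (fineP L m)),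
      WL2.equiv ℂ (fun _ : B9SectCLatticeCarrier.Plaq d (fineP L m) => c₀) W
          (((exp (κ • MP) : PlaqL2K ℂ d (fineP L m) c₀ W →L[ℂ] PlaqL2K ℂ d (fineP L m) c₀ W) :
            PlaqL2K ℂ d (fineP L m) c₀ W →ₗ[ℂ] PlaqL2K ℂ d (fineP L m) c₀ W) g) p =
        Complex.exp (κ * (χ p.1 : ℂ)) • WL2.equiv ℂ (fun _ : B9SectCLatticeCarrier.Plaq d (fineP L m) => c₀) W g p :=
    fun g p => equiv_exp_smul_apply_complex MP (fun p : B9SectCLatticeCarrier.Plaq d (fineP L m) => χ p.1) hMP κ g p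
  have hSPinv : ∀ (g : PlaqL2K ℂ d (fineP L m) c₀ W) (p : B9SectCLatticeCarrier.Plaq d (fineP L m)),
      WL2.equiv ℂ (fun _ : B9SectCLatticeCarrier.Plaq d (fineP L m) => c₀) W
          (((exp (κ • (-MP)) : PlaqL2K ℂ d (fineP L m) c₀ W →L[ℂ] PlaqL2K ℂ d (fineP L m) c₀ W) :
            PlaqL2K ℂ d (fineP L m) c₀ W →ₗ[ℂ] PlaqL2K ℂ d (fineP L m) c₀ W) g) p =
        Complex.exp (-(κ * (χ p.1 : ℂ))) • WL2.equiv ℂ (fun _ : B9SectCLatticeCarrier.Plaq d (fineP L m) => c₀) W g p :=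
    fun g p => equiv_exp_smul_neg_apply_complex MP (fun p : B9SectCLatticeCarrier.Plaq d (fineP L m) => χ p.1) hMP κ g p
  have hSS : ∀ (g : SiteL2K ℂ d (fineP L m) c₀ W) (x : TSite d (fineP L m)),
      WL2.equiv ℂ (fun _ : TSite d (fineP L m) => c₀) W
          (((exp (κ • MS) : SiteL2K ℂ d (fineP L m) c₀ W →L[ℂ] SiteL2K ℂ d (fineP L m) c₀ W) :
            SiteL2K ℂ d (fineP L m) c₀ W →ₗ[ℂ] SiteL2K ℂ d (fineP L m) c₀ W) g) x =
        Complex.exp (κ * (χ x : ℂ)) • WL2.equiv ℂ (fun _ : TSite d (fineP L m) => c₀) W g x :=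
    fun g x => equiv_exp_smul_apply_complex MS χ hMS κ g x
  have hSSinv : ∀ (g : SiteL2K ℂ d (fineP L m) c₀ W) (x : TSite d (fineP L m)),
      WL2.equiv ℂ (fun _ : TSite d (fineP L m) => c₀) W
          (((exp (κ • (-MS)) : SiteL2K ℂ d (fineP L m) c₀ W →L[ℂ] SiteL2K ℂ d (fineP L m) c₀ W) :
            SiteL2K ℂ d (fineP L m) c₀ W →ₗ[ℂ] SiteL2K ℂ d (fineP L m) c₀ W) g) x =
        Complex.exp (-(κ * (χ x : ℂ))) • WL2.equiv ℂ (fun _ : TSite d (fineP L m) => c₀) W g x :=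
    fun g x => equiv_exp_smul_neg_apply_complex MS χ hMS κ g x
  -- the windows and the displayed letters at this `κ`
  have hwinκ : ‖κ‖ * ℓ * η ≤ 1 := by rw [hκr]; exact hwin
  have hβCC' : 4 * ‖κ‖ * ℓ * (Mφ * Mφ') * (d * Real.sqrt d) ≤ β := by rw [hκr]; exact hβCC
  have hβC' : 4 * ‖κ‖ * ℓ * (Mφ * Mφ') * d ≤ β := by rw [hκr]; exact hβC
  have hβD' : 2 * ‖κ‖ * ℓ * (Mφ * Mφ') * Real.sqrt d ≤ β := by rw [hκr]; exact hβD
  -- the coarse multipliers and the factorisation `e^{κM_B}Q†(a•Q)e^{−κM_B} = a•(e^{κM_B}Q†e^{−κM_F})((e^{κM_F}Qe^{−κM_B})·)`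
  have hSF : ∀ (g : BondL2K ℂ d m c₁ W) (b' : Bond d m),
      WL2.equiv ℂ (fun _ : Bond d m => c₁) W
          (((exp (κ • MF) : BondL2K ℂ d m c₁ W →L[ℂ] BondL2K ℂ d m c₁ W) : BondL2K ℂ d m c₁ W →ₗ[ℂ] BondL2K ℂ d m c₁ W) g) b' =
        Complex.exp (κ * (χ' (bpos b') : ℂ)) • WL2.equiv ℂ (fun _ : Bond d m => c₁) W g b' :=
    fun g b' => equiv_exp_smul_apply_complex MF (fun b' => χ' (bpos b')) hMF κ g b'
  have hSFinv : ∀ (g : BondL2K ℂ d m c₁ W) (b' : Bond d m),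
      WL2.equiv ℂ (fun _ : Bond d m => c₁) W
          (((exp (κ • (-MF)) : BondL2K ℂ d m c₁ W →L[ℂ] BondL2K ℂ d m c₁ W) : BondL2K ℂ d m c₁ W →ₗ[ℂ] BondL2K ℂ d m c₁ W) g) b' =
        Complex.exp (-(κ * (χ' (bpos b') : ℂ))) • WL2.equiv ℂ (fun _ : Bond d m => c₁) W g b' :=
    fun g b' => equiv_exp_smul_neg_apply_complex MF (fun b' => χ' (bpos b')) hMF κ g b'
  have hSFi := apply_inv_apply' κ (fun b' : Bond d m => χ' (bpos b')) hSF hSFinv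
  have h := norm_conjG1ofU_le L m φ hφ hφ' hMφ hMφ' hη U hU hRS τ Q a
    (S := ((exp (κ • MB) : BondL2K ℂ d (fineP L m) c₀ W →L[ℂ] BondL2K ℂ d (fineP L m) c₀ W) :
      BondL2K ℂ d (fineP L m) c₀ W →ₗ[ℂ] BondL2K ℂ d (fineP L m) c₀ W))
    (Sinv := ((exp (κ • (-MB)) : BondL2K ℂ d (fineP L m) c₀ W →L[ℂ] BondL2K ℂ d (fineP L m) c₀ W) :
      BondL2K ℂ d (fineP L m) c₀ W →ₗ[ℂ] BondL2K ℂ d (fineP L m) c₀ W))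
    hS hSinv hSP hSPinv hSS hSSinv ha hpos hγ hβ hℓ hρ hρ8 hCP hcoer hKre hχ hwinκ hβCC' hβC' hβD'
    (((exp (κ • MF) : BondL2K ℂ d m c₁ W →L[ℂ] BondL2K ℂ d m c₁ W) : BondL2K ℂ d m c₁ W →ₗ[ℂ] BondL2K ℂ d m c₁ W) ∘ₗ Q ∘ₗ
      ((exp (κ • (-MB)) : BondL2K ℂ d (fineP L m) c₀ W →L[ℂ] BondL2K ℂ d (fineP L m) c₀ W) :
        BondL2K ℂ d (fineP L m) c₀ W →ₗ[ℂ] BondL2K ℂ d (fineP L m) c₀ W))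
    (((exp (κ • MB) : BondL2K ℂ d (fineP L m) c₀ W →L[ℂ] BondL2K ℂ d (fineP L m) c₀ W) :
        BondL2K ℂ d (fineP L m) c₀ W →ₗ[ℂ] BondL2K ℂ d (fineP L m) c₀ W) ∘ₗ LinearMap.adjoint Q ∘ₗ
      ((exp (κ • (-MF)) : BondL2K ℂ d m c₁ W →L[ℂ] BondL2K ℂ d m c₁ W) : BondL2K ℂ d m c₁ W →ₗ[ℂ] BondL2K ℂ d m c₁ W))
    (fun f => by
      have e := hSFi (Q ((exp (κ • (-MB)) : BondL2K ℂ d (fineP L m) c₀ W →L[ℂ] BondL2K ℂ d (fineP L m) c₀ W) f))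
      simp only [ContinuousLinearMap.coe_coe] at e
      simp only [LinearMap.comp_apply, ContinuousLinearMap.coe_coe, map_smul, e])
    (fun f => by simpa only [LinearMap.comp_apply, ContinuousLinearMap.coe_coe] using dQ f)
    (fun g => by simpa only [LinearMap.comp_apply, ContinuousLinearMap.coe_coe] using dQ' g)
    (fun f => by simpa only [LinearMap.comp_apply, ContinuousLinearMap.coe_coe] using dK f)
    (fun s => by simpa only [LinearMap.comp_apply, ContinuousLinearMap.coe_coe] using dR s) hP small v
  simpa only [ContinuousLinearMap.comp_apply, LinearMap.coe_toContinuousLinearMap', LinearMap.comp_apply, ContinuousLinearMap.coe_coe] using h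

end Circle

/-! ## §2 The instance: block decay of `G₁(U)` on the one-step torus, letters with companion -/

section Instance

variable {d : ℕ} {L : ℕ} [NeZero L] {m : Fin d → ℕ} {𝔸 : Type*} [NormedRing 𝔸] [StarRing 𝔸] [NormedAlgebra ℂ 𝔸] [StarModule ℂ 𝔸] [NormOneClass 𝔸]
  {W : Type*} [NormedAddCommGroup W] [InnerProductSpace ℂ W] [FiniteDimensional ℂ W] (φ : W ≃ₗ[ℂ] 𝔸) {Mφ Mφ' : ℝ}
  (hφ : ∀ w, ‖φ w‖ ≤ Mφ * ‖w‖) (hφ' : ∀ X, ‖φ.symm X‖ ≤ Mφ' * ‖X‖) (hMφ : 0 ≤ Mφ) (hMφ' : 0 ≤ Mφ')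
  {c₀ : ℝ} [Fact (0 < c₀)] {η : ℝ} (hη : 0 < η) (hηL : η * L = 1) (U : Bond d (fineP L m) → 𝔸ˣ) (hU : ∀ b, U b ∈ U1 𝔸)
  (hRS : ∀ (b : Bond d (fineP L m)) (v u : W), ⟪adTransportW φ U b v, u⟫_ℂ = ⟪v, adTransportW φ (fun b => (U b)⁻¹) b u⟫_ℂ)
  (τ : 𝔸 →ₗ[ℂ] ℂ) {c₁ : ℝ} [Fact (0 < c₁)] (Q : BondL2K ℂ d (fineP L m) c₀ W →ₗ[ℂ] BondL2K ℂ d m c₁ W) (a : ℝ)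

include hφ hφ' hMφ hMφ' hη hηL hU hRS in
/-- **THE `L²` BLOCK DECAY OF `G₁(U) = Δ_a(U)⁻¹`**: on the one-step torus at the diagonal `ηL = 1`, for `Δ_a(U) = Δ(U) + D_UR(U)D*_U + Q†(a•Q)` of every background
with `U(b) ∈ U1` and mutually adjoint transports, given its `γ`-coercivity (Thm 3.11), the `Δ′` floor `p_K`, the complementary-projection letter `C_P`, the radius
windows (`1 ≤ ℓ`, `rℓη ≤ 1`, `4rℓM_φM_φ′d√d ≤ β`, `4rℓM_φM_φ′d ≤ β`, `2rℓM_φM_φ′√d ≤ β`, `ρ ≤ 1∕8`, `p_K∕2 + (21+3a)β² + 4βC_P + 2ρC_P² + β_K ≤ γ∕4`) and the conjugated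
`Q` ∕ `Δ′` ∕ `R(U)` letters UNIFORMLY over the fine site weights `χ` (bond increments `≤ ℓη`), their coarse companions `χ′` (`|χ′(y) − χ(x)| ≤ ℓ′` on the block
of `y`) and the circle `‖κ‖ = r` (displayed, in `B9Eq3126QG1QInvPointDecay`'s shape): for every bond-block family and every pair of coarse sites
`‖P_{y₁} ∘ G₁(U) ∘ P_{y₀}‖ ≤ (4∕γ)·e^{r}·e^{−r·d_m(y₀,y₁)}`.
[cite: Balaban1985BackgroundPropagators, (3.26) p.395, Thm 3.11 p.416, (3.49) p.399; Balaban1985Variational, (110) p.294] -/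
theorem norm_block_G1ofU_le (ha : 0 ≤ a) (hm : ∀ i, 1 ≤ m i) (hL : 1 ≤ L)
    (hpos : ∀ x : BondL2K ℂ d (fineP L m) c₀ W, x ≠ 0 → 0 < RCLike.re ⟪x, laplaceAofU L m φ η U τ Q a x⟫_ℂ)
    {γ β βK pK ℓ ℓ' r ρ CP : ℝ} (hγ : 0 < γ) (hβ : 0 ≤ β) (hℓ : 1 ≤ ℓ) (hℓ' : 1 ≤ ℓ') (hr : 0 ≤ r) (hρ : 0 ≤ ρ) (hρ8 : ρ ≤ 1 / 8)
    (hCP : 0 ≤ CP)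
    (hcoer : ∀ f : BondL2K ℂ d (fineP L m) c₀ W, γ * ‖f‖ ^ 2 ≤ RCLike.re ⟪f, laplaceAofU L m φ η U τ Q a f⟫_ℂ)
    (hKre : ∀ f : BondL2K ℂ d (fineP L m) c₀ W, -(pK * ‖f‖ ^ 2) ≤ RCLike.re ⟪f, curvOp φ τ η U f⟫_ℂ)
    (hwin : r * ℓ * η ≤ 1)
    (hβCC : 4 * r * ℓ * (Mφ * Mφ') * (d * Real.sqrt d) ≤ β) (hβC : 4 * r * ℓ * (Mφ * Mφ') * d ≤ β)
    (hβD : 2 * r * ℓ * (Mφ * Mφ') * Real.sqrt d ≤ β)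
    (hQK : ∀ (χ : TSite d (fineP L m) → ℝ) (χ' : TSite d m → ℝ),
      (∀ b : Bond d (fineP L m), |χ (bpos b) - χ (btgt b)| ≤ ℓ * η) →
      (∀ (y : TSite d m), ∀ x ∈ B9Eq319QprimeTorus.blockOf L m y, |χ' y - χ x| ≤ ℓ') →
      ∀ (MB : BondL2K ℂ d (fineP L m) c₀ W →L[ℂ] BondL2K ℂ d (fineP L m) c₀ W),
      (∀ (g : BondL2K ℂ d (fineP L m) c₀ W) (b : Bond d (fineP L m)),
        WL2.equiv ℂ (fun _ : Bond d (fineP L m) => c₀) W (MB g) b = (χ (bpos b) : ℂ) • WL2.equiv ℂ (fun _ : Bond d (fineP L m) => c₀) W g b) →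
      ∀ (MS : SiteL2K ℂ d (fineP L m) c₀ W →L[ℂ] SiteL2K ℂ d (fineP L m) c₀ W),
      (∀ (g : SiteL2K ℂ d (fineP L m) c₀ W) (x : TSite d (fineP L m)),
        WL2.equiv ℂ (fun _ : TSite d (fineP L m) => c₀) W (MS g) x = (χ x : ℂ) • WL2.equiv ℂ (fun _ : TSite d (fineP L m) => c₀) W g x) →
      ∀ (MF : BondL2K ℂ d m c₁ W →L[ℂ] BondL2K ℂ d m c₁ W),
      (∀ (g : BondL2K ℂ d m c₁ W) (b' : Bond d m),
        WL2.equiv ℂ (fun _ : Bond d m => c₁) W (MF g) b' = (χ' (bpos b') : ℂ) • WL2.equiv ℂ (fun _ : Bond d m => c₁) W g b') →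
      ∀ κ : ℂ, ‖κ‖ = r →
      (∀ f, ‖exp (κ • MF) (Q (exp (κ • (-MB)) f)) - Q f‖ ≤ β * ‖f‖) ∧
      (∀ g, ‖exp (κ • MB) (LinearMap.adjoint Q (exp (κ • (-MF)) g)) - LinearMap.adjoint Q g‖ ≤ β * ‖g‖) ∧
      (∀ f, ‖exp (κ • MB) (curvOp φ τ η U (exp (κ • (-MB)) f)) - curvOp φ τ η U f‖ ≤ βK * ‖f‖) ∧
      (∀ s, ‖exp (κ • MS) (RofU L m φ η U (c₀ := c₀) (exp (κ • (-MS)) s)) - RofU L m φ η U (c₀ := c₀) s‖ ≤ ρ * ‖s‖))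
    (hP : ∀ f, ‖covDivL2K ℂ c₀ ((η : ℂ))⁻¹ (adTransportW φ fun b => (U b)⁻¹) f -
      RofU L m φ η U (c₀ := c₀) (covDivL2K ℂ c₀ ((η : ℂ))⁻¹ (adTransportW φ fun b => (U b)⁻¹) f)‖ ≤ CP * ‖f‖)
    (small : pK / 2 + (21 + 3 * a) * β ^ 2 + 4 * β * CP + 2 * ρ * CP ^ 2 + βK ≤ γ / 4)
    (PB : TSite d m → BondL2K ℂ d (fineP L m) c₀ W →L[ℂ] BondL2K ℂ d (fineP L m) c₀ W)
    (hPB : ∀ (y : TSite d m) (f : BondL2K ℂ d (fineP L m) c₀ W) (b : Bond d (fineP L m)),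
      WL2.equiv ℂ (fun _ : Bond d (fineP L m) => c₀) W (PB y f) b =
        if blockCoord L m (bpos b) = y then WL2.equiv ℂ (fun _ : Bond d (fineP L m) => c₀) W f b else 0)
    (y₀ y₁ : TSite d m) :
    ‖PB y₁ ∘L LinearMap.toContinuousLinearMap (G1ofU L m φ η U τ hpos) ∘L PB y₀‖ ≤ 4 / γ * Real.exp r * Real.exp (-(r * tdist m y₀ y₁)) := by
  have hL0 : (0 : ℝ) < L := by exact_mod_cast (show 0 < L by omega)
  have hι : 1 / (L : ℝ) ≤ ℓ * η := by
    rw [div_le_iff₀ hL0]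
    calc (1 : ℝ) = 1 * (η * L) := by rw [hηL, mul_one]
      _ ≤ ℓ * (η * L) := by gcongr
      _ = ℓ * η * L := by ring
  refine norm_bondBlock_le_exp_of_uniform_circle_bound L m hm _ hPB hr (by positivity) hι hℓ' (fun χ χ' hχ hχ' MB hMB κ hκr => ?_) y₀ y₁
  -- the plaquette, site and coarse multipliers of this weight pair, the letters at this `κ`, then §1
  obtain ⟨MP, hMP⟩ := exists_pointwise_clm (𝕜 := ℂ) (w := fun _ : B9SectCLatticeCarrier.Plaq d (fineP L m) => c₀) (V := W)
    (fun p : B9SectCLatticeCarrier.Plaq d (fineP L m) => p.1) χ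
  obtain ⟨MS, hMS⟩ := exists_pointwise_clm (𝕜 := ℂ) (w := fun _ : TSite d (fineP L m) => c₀) (V := W) (fun x : TSite d (fineP L m) => x) χ
  obtain ⟨MF, hMF⟩ := exists_pointwise_clm (𝕜 := ℂ) (w := fun _ : Bond d m => c₁) (V := W) (fun b' : Bond d m => bpos b') (fun y => χ' y)
  obtain ⟨dQ, dQ', dK, dR⟩ := hQK χ χ' hχ hχ' MB hMB MS hMS MF hMF κ hκr
  exact norm_conjG1ofU_le_of_circle L m φ hφ hφ' hMφ hMφ' hη U hU hRS τ Q a hMB hMP hMS hMF ha hpos hγ hβ (zero_le_one.trans hℓ) hρ hρ8 hCP hcoer hKre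
    hχ hwin hβCC hβC hβD hP small κ hκr dQ dQ' dK dR

end Instance

end Literature.MathematicalPhysics.QuantumFieldTheory.Balaban1983to89.B9Eq326DeltaABlockDecay

end
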